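import Literature.NumberTheory.LFunctions.ResidueClassRieszMean
import Mathlib.Analysis.SpecialFunctions.Trigonometric.ArctanDeriv
import HarnessLib

/-!
# A log-free bound for the Riesz mean of `Λ_{q,a}`: `ψ₁(x; Λ_{q,a}) − x²/2 ≪ φ(q)(log q + 1) x^{1+σ'}`
# when the `L(s, χ)` mod `q` have no zeros in `σ > σ₁` (`σ' = σ₁ + ε`, `ε log x ≥ 1`)

Topic `Literature/NumberTheory/LFunctions`. Everything in this file is PROVED (theorems only).

By `Literature.NumberTheory.LFunctions.ResidueRiesz.rieszMean_sub_eq_integral` (previous file),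
`ψ₁(x; Λ_{q,a}) − (x−1)²/2 = (1/2π)∫ x^{1+s}F_{q,a}(s) dt/(s(s+1))` on `s = σ' + it`. Bounding the
integrand in absolute value loses a factor `log(1/ε)` near the zeros (`|F_{q,a}| ≍ 1/|s − ρ|`). We
avoid this loss WITHOUT crossing the zeros: the line is cut into the segments
`|t − n/10| < 1/20` (`n ∈ ℤ`), on each of which the local partial fraction of the tree
(`Literature.NumberTheory.LFunctions.DirichletSegments.exists_package`) writes
`F_{q,a} = ∑_{ρ ∈ Z_n} w(ρ)/(s − ρ) + O(φ(q)ℒ_n)`; for a single pole one has the exact identity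
`k(s) − k(ρ) = (ρ − s)(ρ + s + 1) k(s) k(ρ)` for `k(s) = 1/(s(s+1))`, so that
`∫ x^{1+s} k(s) ds/(s − ρ) = k(ρ) ∫ x^{1+s} ds/(s − ρ) + ∫ x^{1+s} (bounded)`, and the oscillatory
integral `∫_a^b e^{itL} dt/(α + i(t − γ))` (`L = log x`, `α = σ' − Re ρ ≥ ε`) is `≤ (2 + π)/(αL)`
uniformly in `a ≤ b` (one integration by parts: `oscillatory_integral_le`). Summing the segments with
`∑_n ℒ_n/(1 + (n/10)²) ≪ log q + 1`:

* `Literature.NumberTheory.LFunctions.ResidueRiesz.abs_rieszMean_sub_le` — an absolute `C` with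
  `|ψ₁(x; Λ_{q,a}) − (x − 1)²/2| ≤ C φ(q)(log q + 1) x^{1+σ₁+ε}` for all `q`, `(a, q) = 1`,
  `1/2 ≤ σ₁`, `ZerosRealPartLE q σ₁`, `0 < ε`, `σ₁ + ε < 1`, `x ≥ 1`, `ε log x ≥ 1`.

With `ε ≍ 1/log x` this is `ψ₁(x; q, a) = x²/(2φ(q)) + O((log q + 1) x^{1+B_q})`, the order-one
analogue, uniform in `q`, of the classical `ψ₁(x) − x²/2 = −∑_ρ x^{ρ+1}/(ρ(ρ+1)) + … ≪ x^{1+Θ}`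
(Montgomery–Vaughan (12.9), Thm. 12.5 with §13.1; Bhowmik–Halupczok–Matsumoto–Suzuki 2019, (3.5)
with Lemma 3), obtained here without the explicit formula.

## References

* H. L. Montgomery, R. C. Vaughan, *Multiplicative Number Theory I. Classical Theory*, CUP 2007,
  §5.1 (5.19), Lemma 12.6, Theorem 12.5, §13.1 (`MontgomeryVaughan2007`).
* G. Bhowmik, K. Halupczok, K. Matsumoto, Y. Suzuki, *Goldbach representations in arithmetic
  progressions and zeros of Dirichlet L-functions*, Mathematika 65 (2019), 57–97, §3 (3.5), Lemma 3
  (`BhowmikHalupczokMatsumotoSuzuki2019`).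
-/

noncomputable section

open Complex Set Metric Filter Topology Real MeasureTheory intervalIntegral
open ArithmeticFunction.vonMangoldt DirichletCharacter

namespace Literature.NumberTheory.LFunctions.ResidueRiesz

/-! ### The oscillatory integral `∫_a^b e^{itL} dt/(α + i(t − γ))` -/

/-- `∫_a^b dt/(α² + (t − γ)²) ≤ π/α` for `α > 0` (the antiderivative is
`(1/α) arctan((t − γ)/α)`, whose total variation is `< π/α`). [folklore] -/
theorem integral_inv_sq_add_sq_le {α : ℝ} (hα : 0 < α) (γ a b : ℝ) :
    ∫ t in a..b, 1 / (α ^ 2 + (t - γ) ^ 2) ≤ π / α := by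
  have hα' : α ≠ 0 := hα.ne'
  have hderiv : ∀ t, HasDerivAt (fun t : ℝ ↦ α⁻¹ * Real.arctan ((t - γ) / α))
      (1 / (α ^ 2 + (t - γ) ^ 2)) t := by
    intro t
    have h1 : HasDerivAt (fun t : ℝ ↦ (t - γ) / α) (1 / α) t := by
      simpa using ((hasDerivAt_id t).sub_const γ).div_const α
    have h2 := (Real.hasDerivAt_arctan ((t - γ) / α)).comp t h1
    have h3 := h2.const_mul α⁻¹
    refine h3.congr_deriv ?_
    field_simp
  have hcont : Continuous fun t : ℝ ↦ 1 / (α ^ 2 + (t - γ) ^ 2) := by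
    refine Continuous.div continuous_const (by fun_prop) fun t ↦ ?_
    positivity
  rw [intervalIntegral.integral_eq_sub_of_hasDerivAt (fun t _ ↦ hderiv t)
    (hcont.intervalIntegrable _ _), ← mul_sub]
  have h1 := Real.arctan_lt_pi_div_two ((b - γ) / α)
  have h2 := Real.neg_pi_div_two_lt_arctan ((a - γ) / α)
  calc α⁻¹ * (Real.arctan ((b - γ) / α) - Real.arctan ((a - γ) / α)) ≤ α⁻¹ * π :=
        mul_le_mul_of_nonneg_left (by linarith) (inv_nonneg.2 hα.le)
    _ = π / α := by rw [inv_mul_eq_div]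

/-- **The oscillatory integral.** For `L > 0`, `α > 0`, real `γ` and `a ≤ b`:
`‖∫_a^b e^{itL} dt/(α + i(t − γ))‖ ≤ (2 + π)/(αL)` — uniformly in the length of the interval.
(Integrate by parts once: `e^{itL}/(α + i(t−γ)) = (1/(iL)) d/dt[e^{itL}/(α + i(t−γ))] + (1/L) e^{itL}/(α + i(t−γ))²`;
the boundary terms are `≤ 2/(αL)` and `∫ dt/(α² + (t−γ)²) ≤ π/α`.) [folklore] -/
theorem oscillatory_integral_le {L α : ℝ} (hL : 0 < L) (hα : 0 < α) (γ : ℝ) {a b : ℝ}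
    (hab : a ≤ b) :
    ‖∫ t in a..b, cexp (I * L * t) / (α + I * (t - γ))‖ ≤ (2 + π) / (α * L) := by
  -- the denominator
  set den : ℝ → ℂ := fun t ↦ (α : ℂ) + I * (t - γ) with hden
  have hden_re : ∀ t, (den t).re = α := by intro t; simp [hden]
  have hden_ne : ∀ t, den t ≠ 0 := by
    intro t h
    have := hden_re t
    rw [h, Complex.zero_re] at this
    linarith
  have hden_norm : ∀ t, α ≤ ‖den t‖ := fun t ↦ by
    calc α = (den t).re := (hden_re t).symm
      _ ≤ ‖den t‖ := re_le_norm _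
  have hden_normsq : ∀ t, ‖den t‖ ^ 2 = α ^ 2 + (t - γ) ^ 2 := by
    intro t
    have : den t = (α : ℂ) + ((t - γ : ℝ) : ℂ) * I := by simp only [hden]; push_cast; ring
    rw [this, Complex.sq_norm, Complex.normSq_add_mul_I]
  have hofReal : ∀ t : ℝ, HasDerivAt (fun t : ℝ ↦ (t : ℂ)) 1 t := fun t ↦ by
    simpa using (hasDerivAt_id t).ofReal_comp
  have hden_deriv : ∀ t, HasDerivAt den I t := by
    intro t
    have h := (((hofReal t).sub_const (γ : ℂ)).const_mul I).const_add (α : ℂ)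
    simp only [mul_one] at h
    exact h
  -- the exponential
  set e : ℝ → ℂ := fun t ↦ cexp (I * L * t) with he
  have he_norm : ∀ t, ‖e t‖ = 1 := by
    intro t
    show ‖cexp (I * L * t)‖ = 1
    rw [show I * (L : ℂ) * (t : ℂ) = ((L * t : ℝ) : ℂ) * I by push_cast; ring, Complex.norm_exp_ofReal_mul_I]
  have he_deriv : ∀ t, HasDerivAt e (I * L * e t) t := by
    intro t
    have h1 : HasDerivAt (fun t : ℝ ↦ I * L * (t : ℂ)) (I * L * 1) t := (hofReal t).const_mul (I * L)
    have h2 := h1.cexp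
    refine h2.congr_deriv ?_
    show cexp (I * L * t) * (I * L * 1) = I * L * cexp (I * L * t)
    ring
  -- `F = e/den` and its derivative
  set F : ℝ → ℂ := fun t ↦ e t / den t with hF
  have hF_deriv : ∀ t, HasDerivAt F (I * L * (e t / den t) - I * (e t / den t ^ 2)) t := by
    intro t
    have hd := hden_ne t
    have h := (he_deriv t).div (hden_deriv t) hd
    refine h.congr_deriv ?_
    field_simp
  have hF_norm : ∀ t, ‖F t‖ ≤ 1 / α := by
    intro t
    show ‖e t / den t‖ ≤ 1 / α
    rw [norm_div, he_norm]
    exact one_div_le_one_div_of_le hα (hden_norm t)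
  -- continuity facts
  have hden_cont : Continuous den := by rw [hden]; fun_prop
  have he_cont : Continuous e := by rw [he]; fun_prop
  have hF_cont : Continuous F := by
    rw [hF]; exact he_cont.div hden_cont hden_ne
  have hG_cont : Continuous fun t ↦ e t / den t ^ 2 :=
    he_cont.div (hden_cont.pow 2) fun t ↦ pow_ne_zero 2 (hden_ne t)
  have hF'_cont : Continuous fun t ↦ I * L * (e t / den t) - I * (e t / den t ^ 2) :=
    ((hF_cont.const_mul _).sub (hG_cont.const_mul _))
  -- the identity `e/den = (1/(IL)) F' + (1/L) e/den²`
  have hIL : (I * L : ℂ) ≠ 0 := mul_ne_zero I_ne_zero (by exact_mod_cast hL.ne')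
  have hL' : (L : ℂ) ≠ 0 := by exact_mod_cast hL.ne'
  have hpt : ∀ t, e t / den t =
      (1 / (I * L)) * (I * L * (e t / den t) - I * (e t / den t ^ 2)) + (1 / L) * (e t / den t ^ 2) := by
    intro t
    have hd := hden_ne t
    field_simp
    ring
  have hint1 : IntervalIntegrable (fun t ↦ I * L * (e t / den t) - I * (e t / den t ^ 2)) volume a b :=
    hF'_cont.intervalIntegrable _ _
  have hint2 : IntervalIntegrable (fun t ↦ e t / den t ^ 2) volume a b := hG_cont.intervalIntegrable _ _
  have hFTC : ∫ t in a..b, (I * L * (e t / den t) - I * (e t / den t ^ 2)) = F b - F a :=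
    intervalIntegral.integral_eq_sub_of_hasDerivAt (fun t _ ↦ hF_deriv t) hint1
  have hsplit : ∫ t in a..b, e t / den t =
      (1 / (I * L)) * (F b - F a) + (1 / L) * ∫ t in a..b, e t / den t ^ 2 := by
    rw [intervalIntegral.integral_congr (fun t _ ↦ hpt t), intervalIntegral.integral_add
      (hint1.const_mul _) (hint2.const_mul _), intervalIntegral.integral_const_mul,
      intervalIntegral.integral_const_mul, hFTC]
  -- bound for the remaining integral
  have hrest : ‖∫ t in a..b, e t / den t ^ 2‖ ≤ π / α := by
    calc ‖∫ t in a..b, e t / den t ^ 2‖ ≤ ∫ t in a..b, ‖e t / den t ^ 2‖ :=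
          intervalIntegral.norm_integral_le_integral_norm hab
      _ = ∫ t in a..b, 1 / (α ^ 2 + (t - γ) ^ 2) := by
          refine intervalIntegral.integral_congr fun t _ ↦ ?_
          show ‖e t / den t ^ 2‖ = 1 / (α ^ 2 + (t - γ) ^ 2)
          rw [norm_div, he_norm, norm_pow, hden_normsq]
      _ ≤ π / α := integral_inv_sq_add_sq_le hα γ a b
  -- assemble
  change ‖∫ t in a..b, e t / den t‖ ≤ (2 + π) / (α * L)
  rw [hsplit]
  have hnIL : ‖(1 / (I * L) : ℂ)‖ = 1 / L := by
    rw [norm_div, norm_one, norm_mul, Complex.norm_I, one_mul, Complex.norm_real,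
      Real.norm_of_nonneg hL.le]
  have hnL : ‖(1 / L : ℂ)‖ = 1 / L := by
    rw [show (1 / L : ℂ) = ((1 / L : ℝ) : ℂ) by push_cast; rfl, Complex.norm_real,
      Real.norm_of_nonneg (by positivity)]
  calc ‖(1 / (I * L)) * (F b - F a) + (1 / L) * ∫ t in a..b, e t / den t ^ 2‖
      ≤ ‖(1 / (I * L)) * (F b - F a)‖ + ‖(1 / L) * ∫ t in a..b, e t / den t ^ 2‖ := norm_add_le _ _
    _ = (1 / L) * ‖F b - F a‖ + (1 / L) * ‖∫ t in a..b, e t / den t ^ 2‖ := by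
        rw [norm_mul, norm_mul, hnIL, hnL]
    _ ≤ (1 / L) * (1 / α + 1 / α) + (1 / L) * (π / α) := by
        gcongr
        exact (norm_sub_le _ _).trans (add_le_add (hF_norm b) (hF_norm a))
    _ = (2 + π) / (α * L) := by field_simp; ring

/-! ### The segments `|t − n/10| < 1/20` -/

/-- The segment `S_n = [n/10 − 1/20, n/10 + 1/20)`. [folklore] -/
def seg (n : ℤ) : Set ℝ := Ico ((n : ℝ) / 10 - 1 / 20) ((n : ℝ) / 10 + 1 / 20)

/-- `S_n` is measurable. [folklore] -/
theorem measurableSet_seg (n : ℤ) : MeasurableSet (seg n) := measurableSet_Ico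

/-- The segments are pairwise disjoint. [folklore] -/
theorem pairwise_disjoint_seg : Pairwise (Function.onFun Disjoint seg) := by
  intro m n hmn
  rw [Function.onFun, seg, seg, Set.Ico_disjoint_Ico]
  rcases lt_or_gt_of_ne hmn with h | h
  · have h' : (m : ℝ) + 1 ≤ n := by exact_mod_cast h
    rw [min_eq_left (by linarith), max_eq_right (by linarith)]
    linarith
  · have h' : (n : ℝ) + 1 ≤ m := by exact_mod_cast h
    rw [min_eq_right (by linarith), max_eq_left (by linarith)]
    linarith

/-- The segments cover `ℝ`. [folklore] -/
theorem iUnion_seg : (⋃ n : ℤ, seg n) = univ := by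
  refine eq_univ_of_forall fun t ↦ mem_iUnion.2 ⟨⌊10 * t + 1 / 2⌋, ?_⟩
  have h1 := Int.floor_le (10 * t + 1 / 2)
  have h2 := Int.lt_floor_add_one (10 * t + 1 / 2)
  constructor
  · linarith
  · linarith

/-- `|S_n| = 1/10`. [folklore] -/
theorem volume_real_seg (n : ℤ) : volume.real (seg n) = 1 / 10 := by
  rw [Measure.real, seg, Real.volume_Ico, ENNReal.toReal_ofReal (by norm_num)]
  norm_num

/-- On `S_n`: `|t − n/10| ≤ 1/20`. [folklore] -/
theorem abs_sub_le_of_mem_seg {n : ℤ} {t : ℝ} (ht : t ∈ seg n) : |t - n / 10| ≤ 1 / 20 := by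
  rw [seg, mem_Ico] at ht
  rw [abs_le]; constructor <;> linarith [ht.1, ht.2]

/-- On `S_n`: `1/(1 + t²) ≤ 3/(1 + (n/10)²)`. [folklore] -/
theorem inv_one_add_sq_le_of_mem_seg {n : ℤ} {t : ℝ} (ht : t ∈ seg n) :
    (1 + t ^ 2)⁻¹ ≤ 3 * (1 + ((n : ℝ) / 10) ^ 2)⁻¹ := by
  have h := abs_le.1 (abs_sub_le_of_mem_seg ht)
  have h2 : (t - n / 10) ^ 2 ≤ 1 / 400 := by nlinarith [h.1, h.2]
  rw [← div_eq_mul_inv, le_div_iff₀ (by positivity), inv_mul_eq_div, div_le_iff₀ (by positivity)]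
  nlinarith [sq_nonneg (2 * t - n / 10), sq_nonneg t]

/-- For `t ∈ S_n`: `log(|t| + 4) ≤ log(|n/10| + 4) + 1`, hence
`log q + log(|t|+4) ≤ 2 (log q + log(|n/10| + 4))`. [folklore] -/
theorem ell_le_two_mul_of_mem_seg (q : ℕ) {n : ℤ} {t : ℝ} (ht : t ∈ seg n) :
    Real.log q + Real.log (|t| + 4) ≤ 2 * (Real.log q + Real.log (|(n : ℝ) / 10| + 4)) := by
  have h := abs_le.1 (abs_sub_le_of_mem_seg ht)
  have hlogq : 0 ≤ Real.log q := Real.log_natCast_nonneg q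
  have h1 : |t| ≤ |(n : ℝ) / 10| + 1 / 20 := by
    calc |t| = |(t - n / 10) + n / 10| := by ring_nf
      _ ≤ |t - n / 10| + |(n : ℝ) / 10| := abs_add_le _ _
      _ ≤ _ := by linarith [abs_sub_le_of_mem_seg ht]
  have h2 : Real.log (|t| + 4) ≤ Real.log (|(n : ℝ) / 10| + 4) + 1 := by
    have hpos : 0 < |(n : ℝ) / 10| + 4 := by positivity
    calc Real.log (|t| + 4) ≤ Real.log (2 * (|(n : ℝ) / 10| + 4)) :=
          Real.log_le_log (by positivity) (by linarith [abs_nonneg ((n : ℝ) / 10)])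
      _ = Real.log 2 + Real.log (|(n : ℝ) / 10| + 4) := Real.log_mul (by norm_num) hpos.ne'
      _ ≤ _ := by linarith [Real.log_two_lt_d9]
  have h3 : 1 ≤ Real.log (|(n : ℝ) / 10| + 4) := ClassicalZFRData.one_le_log_tau _
  linarith

/-- The weights `ℒ_n/(1 + (n/10)²)` are summable over `n ∈ ℤ`; precisely
`log(|n/10| + 4)/(1 + (n/10)²) ≤ 1000 (|n|^{-3/2} + 𝟙_{n = 0})`. [folklore] -/
theorem summable_seg_weight :
    Summable fun n : ℤ ↦ Real.log (|(n : ℝ) / 10| + 4) * (1 + ((n : ℝ) / 10) ^ 2)⁻¹ := by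
  have hmaj : Summable fun n : ℤ ↦ (1000 : ℝ) * (|(n : ℝ)| ^ (-(3 / 2 : ℝ)) + if n = 0 then 1 else 0) := by
    refine ((Real.summable_abs_int_rpow (by norm_num : (1 : ℝ) < 3 / 2)).add ?_).mul_left 1000
    exact (hasSum_ite_eq (0 : ℤ) (1 : ℝ)).summable
  refine Summable.of_nonneg_of_le
    (fun n ↦ mul_nonneg (Real.log_nonneg (by linarith [abs_nonneg ((n : ℝ) / 10)])) (by positivity))
    (fun n ↦ ?_) hmaj
  have hlog : Real.log (|(n : ℝ) / 10| + 4) ≤ 5 * |(n : ℝ) / 10| ^ (1 / 2 : ℝ) ∨ |(n : ℝ) / 10| < 1 := by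
    rcases le_or_gt 1 |(n : ℝ) / 10| with h | h
    · exact Or.inl (ClassicalPsiData.log_tau_le_rpow h)
    · exact Or.inr h
  rcases eq_or_ne n 0 with rfl | hn0
  · simp only [Int.cast_zero, zero_div, abs_zero, zero_add, ne_eq, OfNat.ofNat_ne_zero,
      not_false_eq_true, zero_pow, add_zero, inv_one, mul_one, ↓reduceIte]
    have : Real.log 4 ≤ 4 := by
      have := Real.log_le_sub_one_of_pos (show (0 : ℝ) < 4 by norm_num); linarith
    have h0 : (0 : ℝ) ≤ |(0 : ℝ)| ^ (-(3 / 2 : ℝ)) := by positivity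
    linarith
  · simp only [hn0, ↓reduceIte, add_zero]
    have hn1 : (1 : ℝ) ≤ |(n : ℝ)| := by
      have : (1 : ℤ) ≤ |n| := Int.one_le_abs hn0
      exact_mod_cast this
    have hnpos : (0 : ℝ) < |(n : ℝ)| := by linarith
    -- `log(|n|/10 + 4) ≤ 5 |n|^{1/2}` in both cases
    have hlog' : Real.log (|(n : ℝ) / 10| + 4) ≤ 5 * |(n : ℝ)| ^ (1 / 2 : ℝ) := by
      have hmono : |(n : ℝ) / 10| ^ (1 / 2 : ℝ) ≤ |(n : ℝ)| ^ (1 / 2 : ℝ) :=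
        Real.rpow_le_rpow (abs_nonneg _) (by rw [abs_div]; norm_num; linarith [abs_nonneg (n:ℝ)])
          (by norm_num)
      rcases hlog with h | h
      · linarith
      · have h5 : Real.log (|(n : ℝ) / 10| + 4) ≤ Real.log 5 :=
          Real.log_le_log (by positivity) (by linarith)
        have hl5 : Real.log 5 ≤ 5 := by
          have := Real.log_le_sub_one_of_pos (show (0 : ℝ) < 5 by norm_num); linarith
        have h1r : (1 : ℝ) ≤ |(n : ℝ)| ^ (1 / 2 : ℝ) := Real.one_le_rpow hn1 (by norm_num)
        linarith
    -- `1/(1 + (n/10)²) ≤ 100/|n|²`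
    have hinv : (1 + ((n : ℝ) / 10) ^ 2)⁻¹ ≤ 100 * |(n : ℝ)| ^ (-(2 : ℝ)) := by
      rw [Real.rpow_neg (abs_nonneg _), Real.rpow_two, sq_abs, ← div_eq_mul_inv,
        le_div_iff₀ (by positivity), inv_mul_eq_div, div_le_iff₀ (by positivity)]
      nlinarith [sq_nonneg (n : ℝ)]
    calc Real.log (|(n : ℝ) / 10| + 4) * (1 + ((n : ℝ) / 10) ^ 2)⁻¹
        ≤ (5 * |(n : ℝ)| ^ (1 / 2 : ℝ)) * (100 * |(n : ℝ)| ^ (-(2 : ℝ))) :=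
          mul_le_mul hlog' hinv (by positivity) (by positivity)
      _ = 500 * |(n : ℝ)| ^ (-(3 / 2 : ℝ)) := by
          rw [show (-(3 / 2 : ℝ)) = 1 / 2 + -(2 : ℝ) by norm_num, Real.rpow_add hnpos]; ring
      _ ≤ 1000 * |(n : ℝ)| ^ (-(3 / 2 : ℝ)) := by
          have : 0 ≤ |(n : ℝ)| ^ (-(3 / 2 : ℝ)) := by positivity
          linarith

/-! ### Pointwise bounds for the kernel pieces near a zero -/

/-- The exact identity behind the log-free estimate: for `s, ρ ≠ 0, −1`,
`k(s)/(s − ρ) = k(ρ)/(s − ρ) − (ρ + s + 1) k(s) k(ρ)` with `k(s) = 1/(s(s+1))`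
(`k(s) − k(ρ) = (ρ − s)(ρ + s + 1)/(s(s+1)ρ(ρ+1))`). [folklore] -/
theorem kernel_div_sub_eq {s ρ : ℂ} (hs0 : s ≠ 0) (hs1 : s + 1 ≠ 0) (hρ0 : ρ ≠ 0) (hρ1 : ρ + 1 ≠ 0)
    (hsρ : s ≠ ρ) :
    1 / (s * (s + 1)) / (s - ρ) =
      1 / (ρ * (ρ + 1)) / (s - ρ) - (ρ + s + 1) / (s * (s + 1) * (ρ * (ρ + 1))) := by
  have hsρ' : s - ρ ≠ 0 := sub_ne_zero.2 hsρ
  field_simp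
  ring

/-- Size of `k(ρ) = 1/(ρ(ρ+1))` for a zero `ρ` of the segment package at centre `T = n/10`:
`3/20 ≤ Re ρ`, `|Im ρ − T| ≤ 2` give `‖k(ρ)‖ ≤ 120/(1 + T²)`. [folklore] -/
theorem norm_kernel_zero_le {ρ : ℂ} {T : ℝ} (hre : 3 / 20 ≤ ρ.re) (him : |ρ.im - T| ≤ 2) :
    ‖1 / (ρ * (ρ + 1))‖ ≤ 120 * (1 + T ^ 2)⁻¹ := by
  have hρ : 3 / 20 ≤ ‖ρ‖ := hre.trans (re_le_norm ρ)
  have hρ1 : 1 ≤ ‖ρ + 1‖ := by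
    have : (ρ + 1).re = ρ.re + 1 := by simp
    calc (1 : ℝ) ≤ (ρ + 1).re := by rw [this]; linarith
      _ ≤ ‖ρ + 1‖ := re_le_norm _
  have hρim : |ρ.im| ≤ ‖ρ‖ := abs_im_le_norm ρ
  have hρim1 : |ρ.im| ≤ ‖ρ + 1‖ := by simpa using abs_im_le_norm (ρ + 1)
  have him' := abs_le.1 him
  rw [norm_div, norm_one, norm_mul, ← div_eq_mul_inv, div_le_div_iff₀ (by positivity) (by positivity),
    one_mul]
  -- `1 + T² ≤ 120 ‖ρ‖ ‖ρ+1‖`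
  rcases le_or_gt |T| 4 with hT | hT
  · have hT2 : T ^ 2 ≤ 16 := by have := abs_le.1 hT; nlinarith
    have h := mul_le_mul hρ hρ1 zero_le_one (norm_nonneg _)
    calc 1 + T ^ 2 ≤ 120 * (3 / 20 * 1) := by linarith
      _ ≤ 120 * (‖ρ‖ * ‖ρ + 1‖) := by gcongr
  · -- `|Im ρ| ≥ |T| − 2 ≥ |T|/2`
    have h1 : |T| - 2 ≤ |ρ.im| := by
      rcases le_or_gt 0 T with hT0 | hT0
      · rw [abs_of_nonneg hT0]
        exact le_trans (by linarith [him'.1]) (le_abs_self ρ.im)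
      · rw [abs_of_neg hT0]
        exact le_trans (by linarith [him'.2]) (neg_le_abs ρ.im)
    have h2 : |T| / 2 ≤ |ρ.im| := by linarith
    have h3 : |T| / 2 ≤ ‖ρ‖ := h2.trans hρim
    have h4 : |T| / 2 ≤ ‖ρ + 1‖ := h2.trans hρim1
    have hT' : T ^ 2 = |T| ^ 2 := (sq_abs T).symm
    have h34 := mul_le_mul h3 h4 (by positivity) (norm_nonneg _)
    calc 1 + T ^ 2 ≤ 120 * (|T| / 2 * (|T| / 2)) := by nlinarith
      _ ≤ 120 * (‖ρ‖ * ‖ρ + 1‖) := by gcongr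

/-- Size of the correction term on the segment: for `s = σ' + it` with `1/2 ≤ σ' ≤ 2`,
`|t − T| ≤ 1/20`, and `ρ` with `3/20 ≤ Re ρ ≤ 2`, `|Im ρ − T| ≤ 2`:
`‖(ρ + s + 1)/(s(s+1)ρ(ρ+1))‖ ≤ 4000/(1 + T²)`. [folklore] -/
theorem norm_correction_le {σ' t T : ℝ} {ρ : ℂ} (hσ' : 1 / 2 ≤ σ') (hσ'2 : σ' ≤ 2)
    (ht : |t - T| ≤ 1 / 20) (hre : 3 / 20 ≤ ρ.re) (hre2 : ρ.re ≤ 2) (him : |ρ.im - T| ≤ 2) :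
    ‖(ρ + (σ' + t * I) + 1) / ((σ' + t * I) * (σ' + t * I + 1) * (ρ * (ρ + 1)))‖ ≤
      4000 * (1 + T ^ 2)⁻¹ := by
  set s : ℂ := σ' + t * I with hs
  have hsre : s.re = σ' := by simp [hs]
  have hsim : s.im = t := by simp [hs]
  have hs_norm : 1 / 2 ≤ ‖s‖ := by rw [← hsre] at hσ'; exact hσ'.trans (re_le_norm s)
  have hs1_norm : 3 / 2 ≤ ‖s + 1‖ := by
    have : (s + 1).re = σ' + 1 := by simp [hs]
    calc (3 : ℝ) / 2 ≤ (s + 1).re := by rw [this]; linarith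
      _ ≤ ‖s + 1‖ := re_le_norm _
  have hρ : 3 / 20 ≤ ‖ρ‖ := hre.trans (re_le_norm ρ)
  have hρ1 : 1 ≤ ‖ρ + 1‖ := by
    have : (ρ + 1).re = ρ.re + 1 := by simp
    calc (1 : ℝ) ≤ (ρ + 1).re := by rw [this]; linarith
      _ ≤ ‖ρ + 1‖ := re_le_norm _
  have hsim' : |t| ≤ ‖s‖ := by rw [← hsim]; exact abs_im_le_norm s
  have hs1im : |t| ≤ ‖s + 1‖ := by simpa [hs] using abs_im_le_norm (s + 1)
  have hρim : |ρ.im| ≤ ‖ρ‖ := abs_im_le_norm ρ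
  have hρim1 : |ρ.im| ≤ ‖ρ + 1‖ := by simpa using abs_im_le_norm (ρ + 1)
  have ht' := abs_le.1 ht
  have him' := abs_le.1 him
  -- numerator
  have hnum : ‖ρ + s + 1‖ ≤ |T| + |T| + 8 := by
    have e1 : ‖ρ‖ ≤ |ρ.re| + |ρ.im| := Complex.norm_le_abs_re_add_abs_im ρ
    have e2 : ‖s‖ ≤ |s.re| + |s.im| := Complex.norm_le_abs_re_add_abs_im s
    rw [hsre, hsim] at e2
    have e3 : |ρ.re| ≤ 2 := by rw [abs_le]; constructor <;> linarith
    have e4 : |σ'| ≤ 2 := by rw [abs_le]; constructor <;> linarith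
    have e5 : |ρ.im| ≤ |T| + 2 := by
      calc |ρ.im| = |(ρ.im - T) + T| := by ring_nf
        _ ≤ |ρ.im - T| + |T| := abs_add_le _ _
        _ ≤ _ := by linarith
    have e6 : |t| ≤ |T| + 1 / 20 := by
      calc |t| = |(t - T) + T| := by ring_nf
        _ ≤ |t - T| + |T| := abs_add_le _ _
        _ ≤ _ := by linarith
    calc ‖ρ + s + 1‖ ≤ ‖ρ‖ + ‖s‖ + ‖(1 : ℂ)‖ := by
          refine (norm_add_le _ _).trans (add_le_add (norm_add_le _ _) le_rfl)
      _ ≤ (|ρ.re| + |ρ.im|) + (|σ'| + |t|) + 1 := by rw [norm_one]; gcongr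
      _ ≤ _ := by linarith
  rw [norm_div, norm_mul, norm_mul, norm_mul, ← div_eq_mul_inv,
    div_le_div_iff₀ (by positivity) (by positivity)]
  rcases le_or_gt |T| 4 with hT | hT
  · have hT2 : T ^ 2 ≤ 16 := by have := abs_le.1 hT; nlinarith
    have hden : (3 : ℝ) / 4 * (3 / 20) ≤ ‖s‖ * ‖s + 1‖ * (‖ρ‖ * ‖ρ + 1‖) := by
      have h1 : (1 : ℝ) / 2 * (3 / 2) ≤ ‖s‖ * ‖s + 1‖ :=
        mul_le_mul hs_norm hs1_norm (by norm_num) (norm_nonneg _)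
      have h2 : (3 : ℝ) / 20 * 1 ≤ ‖ρ‖ * ‖ρ + 1‖ :=
        mul_le_mul hρ hρ1 (by norm_num) (norm_nonneg _)
      calc (3 : ℝ) / 4 * (3 / 20) = (1 / 2 * (3 / 2)) * (3 / 20 * 1) := by norm_num
        _ ≤ _ := mul_le_mul h1 h2 (by norm_num) (by positivity)
    have hnum' : ‖ρ + s + 1‖ ≤ 16 := by linarith
    calc ‖ρ + s + 1‖ * (1 + T ^ 2) ≤ 16 * 17 := mul_le_mul hnum' (by linarith) (by positivity) (by norm_num)
      _ ≤ 4000 * ((3 : ℝ) / 4 * (3 / 20)) := by norm_num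
      _ ≤ 4000 * (‖s‖ * ‖s + 1‖ * (‖ρ‖ * ‖ρ + 1‖)) := by gcongr
  · -- all four norms are `≥ |T|/2`
    have h1 : |T| - 2 ≤ |ρ.im| := by
      rcases le_or_gt 0 T with hT0 | hT0
      · rw [abs_of_nonneg hT0]
        exact le_trans (by linarith) (le_abs_self ρ.im)
      · rw [abs_of_neg hT0]
        exact le_trans (by linarith) (neg_le_abs ρ.im)
    have h2 : |T| - 1 / 20 ≤ |t| := by
      rcases le_or_gt 0 T with hT0 | hT0
      · rw [abs_of_nonneg hT0]
        exact le_trans (by linarith) (le_abs_self t)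
      · rw [abs_of_neg hT0]
        exact le_trans (by linarith) (neg_le_abs t)
    have ha : |T| / 2 ≤ ‖s‖ := le_trans (by linarith) hsim'
    have hb : |T| / 2 ≤ ‖s + 1‖ := le_trans (by linarith) hs1im
    have hc : |T| / 2 ≤ ‖ρ‖ := le_trans (by linarith) hρim
    have hd : |T| / 2 ≤ ‖ρ + 1‖ := le_trans (by linarith) hρim1
    have hT' : T ^ 2 = |T| ^ 2 := (sq_abs T).symm
    have hab : |T| / 2 * (|T| / 2) ≤ ‖s‖ * ‖s + 1‖ := mul_le_mul ha hb (by positivity) (norm_nonneg _)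
    have hcd : |T| / 2 * (|T| / 2) ≤ ‖ρ‖ * ‖ρ + 1‖ := mul_le_mul hc hd (by positivity) (norm_nonneg _)
    have habcd : |T| / 2 * (|T| / 2) * (|T| / 2 * (|T| / 2)) ≤ ‖s‖ * ‖s + 1‖ * (‖ρ‖ * ‖ρ + 1‖) :=
      mul_le_mul hab hcd (by positivity) (by positivity)
    have hnum' : ‖ρ + s + 1‖ ≤ 4 * |T| := by linarith
    have h1T : 1 + T ^ 2 ≤ 2 * |T| ^ 2 := by nlinarith
    calc ‖ρ + s + 1‖ * (1 + T ^ 2) ≤ (4 * |T|) * (2 * |T| ^ 2) :=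
          mul_le_mul hnum' h1T (by positivity) (by positivity)
      _ = 8 * |T| ^ 3 := by ring
      _ ≤ 250 * |T| ^ 4 := by nlinarith [pow_pos (show (0:ℝ) < |T| by linarith) 3]
      _ = 4000 * (|T| / 2 * (|T| / 2) * (|T| / 2 * (|T| / 2))) := by ring
      _ ≤ 4000 * (‖s‖ * ‖s + 1‖ * (‖ρ‖ * ‖ρ + 1‖)) := by gcongr

/-! ### The polar piece on a segment -/

/-- **The integral of one polar term over a segment, without logarithms.** For `x > 0`,
`1/2 ≤ σ' ≤ 2`, and `ρ` with `3/20 ≤ Re ρ ≤ 2`, `Re ρ < σ'`, `|Im ρ − n/10| ≤ 2` and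
`(σ' − Re ρ) log x ≥ 1`:
`‖∫_{S_n} x^{1+s} ds/(s(s+1)(s − ρ))‖ ≤ (120(2+π) + 400) x^{1+σ'}/(1 + (n/10)²)`, `s = σ' + it`
(the exact identity `kernel_div_sub_eq` and the oscillatory integral). [folklore] -/
theorem norm_integral_seg_polar_le {x σ' : ℝ} (hx0 : 0 < x) (hσ' : 1 / 2 ≤ σ') (hσ'2 : σ' ≤ 2)
    {ρ : ℂ} (hre : 3 / 20 ≤ ρ.re) (hre2 : ρ.re ≤ 2) (hρσ : ρ.re < σ') (n : ℤ)
    (him : |ρ.im - n / 10| ≤ 2) (hlogx : 0 < Real.log x) (hlog : 1 ≤ (σ' - ρ.re) * Real.log x) :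
    ‖∫ t in seg n, (x : ℂ) ^ (1 + ((σ' : ℂ) + t * I)) * (1 / (((σ' : ℂ) + t * I) * ((σ' : ℂ) + t * I + 1))) /
        ((σ' : ℂ) + t * I - ρ)‖ ≤
      x ^ (1 + σ') * ((120 * (2 + π) + 400) * (1 + ((n : ℝ) / 10) ^ 2)⁻¹) := by
  set T : ℝ := (n : ℝ) / 10 with hT
  set α : ℝ := σ' - ρ.re with hα
  have hα0 : 0 < α := by rw [hα]; linarith
  have hx0' : (x : ℂ) ≠ 0 := ofReal_ne_zero.2 hx0.ne'
  have hρ0 : ρ ≠ 0 := by intro h; rw [h] at hre; simp at hre; linarith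
  have hρ1 : ρ + 1 ≠ 0 := by
    intro h
    have : ρ.re = -1 := by have := congrArg Complex.re h; simp at this; linarith
    linarith
  have hxpow : ∀ t : ℝ, ‖(x : ℂ) ^ (1 + ((σ' : ℂ) + t * I))‖ = x ^ (1 + σ') := by
    intro t
    rw [norm_cpow_eq_rpow_re_of_pos hx0]
    simp
  have hxp : 0 ≤ x ^ (1 + σ') := (Real.rpow_pos_of_pos hx0 _).le
  -- facts on the segment
  have hs0 : ∀ t : ℝ, ((σ' : ℂ) + t * I) ≠ 0 := by
    intro t h; have := congrArg Complex.re h; simp at this; linarith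
  have hs1 : ∀ t : ℝ, ((σ' : ℂ) + t * I) + 1 ≠ 0 := by
    intro t h; have := congrArg Complex.re h; simp at this; linarith
  have hsρ : ∀ t : ℝ, ((σ' : ℂ) + t * I) ≠ ρ := by
    intro t h; have := congrArg Complex.re h; simp at this; linarith
  have hvol : volume (seg n) < ⊤ := by rw [seg, Real.volume_Ico]; exact ENNReal.ofReal_lt_top
  -- the two pieces
  set corr : ℝ → ℂ := fun t ↦ (x : ℂ) ^ (1 + ((σ' : ℂ) + t * I)) *
    ((ρ + (σ' + t * I) + 1) / (((σ' : ℂ) + t * I) * ((σ' : ℂ) + t * I + 1) * (ρ * (ρ + 1)))) with hcorr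
  set osc : ℝ → ℂ := fun t ↦ (x : ℂ) ^ (1 + ((σ' : ℂ) + t * I)) / ((σ' : ℂ) + t * I - ρ) with hosc
  have hP_eq : ∀ t : ℝ, (x : ℂ) ^ (1 + ((σ' : ℂ) + t * I)) *
      (1 / (((σ' : ℂ) + t * I) * ((σ' : ℂ) + t * I + 1))) / ((σ' : ℂ) + t * I - ρ) =
      (1 / (ρ * (ρ + 1))) * osc t - corr t := by
    intro t
    simp only [hosc, hcorr]
    rw [mul_div_assoc, kernel_div_sub_eq (hs0 t) (hs1 t) hρ0 hρ1 (hsρ t)]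
    ring
  -- continuity
  have hcpow : Continuous fun t : ℝ ↦ (x : ℂ) ^ (1 + ((σ' : ℂ) + t * I)) := by
    refine continuous_iff_continuousAt.2 fun t ↦ ?_
    exact (continuousAt_const_cpow hx0').comp (f := fun t : ℝ ↦ 1 + ((σ' : ℂ) + t * I)) (by fun_prop)
  have hcorr_cont : Continuous corr := by
    rw [hcorr]
    refine hcpow.mul (Continuous.div (by fun_prop) (by fun_prop) fun t ↦ ?_)
    exact mul_ne_zero (mul_ne_zero (hs0 t) (hs1 t)) (mul_ne_zero hρ0 hρ1)
  have hosc_cont : Continuous osc := by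
    rw [hosc]
    exact hcpow.div (by fun_prop) fun t ↦ sub_ne_zero.2 (hsρ t)
  -- the correction integral
  have hcorr_bound : ∀ t ∈ seg n, ‖corr t‖ ≤ x ^ (1 + σ') * (4000 * (1 + T ^ 2)⁻¹) := by
    intro t ht
    show ‖(x : ℂ) ^ (1 + ((σ' : ℂ) + t * I)) *
      ((ρ + (σ' + t * I) + 1) / (((σ' : ℂ) + t * I) * ((σ' : ℂ) + t * I + 1) * (ρ * (ρ + 1))))‖ ≤ _
    rw [norm_mul, hxpow t]
    exact mul_le_mul_of_nonneg_left
      (norm_correction_le hσ' hσ'2 (abs_sub_le_of_mem_seg ht) hre hre2 him) hxp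
  have hcorr_int : ‖∫ t in seg n, corr t‖ ≤ x ^ (1 + σ') * (4000 * (1 + T ^ 2)⁻¹) * (1 / 10) := by
    have := norm_setIntegral_le_of_norm_le_const hvol hcorr_bound
    rwa [volume_real_seg] at this
  -- the oscillatory integral
  have hosc_eq : ∀ t : ℝ, osc t = (x : ℂ) ^ (((1 + σ' : ℝ)) : ℂ) *
      (cexp (I * Real.log x * t) / (α + I * (t - ρ.im))) := by
    intro t
    show (x : ℂ) ^ (1 + ((σ' : ℂ) + t * I)) / ((σ' : ℂ) + t * I - ρ) = _
    have h1 : (1 : ℂ) + ((σ' : ℂ) + t * I) = (((1 + σ' : ℝ)) : ℂ) + ((t : ℂ) * I) := by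
      push_cast; ring
    have h2 : (x : ℂ) ^ ((t : ℂ) * I) = cexp (I * Real.log x * t) := by
      rw [cpow_def_of_ne_zero hx0', ← ofReal_log hx0.le]
      ring_nf
    have h3 : ((σ' : ℂ) + t * I - ρ) = (α : ℂ) + I * (t - ρ.im) := by
      rw [hα]
      conv_lhs => rw [← re_add_im ρ]
      push_cast
      ring
    rw [h1, cpow_add _ _ hx0', h2, h3, mul_div_assoc]
  have hseg_eq : ∫ t in seg n, osc t = ∫ t in (T - 1 / 20)..(T + 1 / 20), osc t := by
    rw [intervalIntegral.integral_of_le (by linarith), seg, integral_Ico_eq_integral_Ioo,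
      ← integral_Ioc_eq_integral_Ioo, hT]
  have hosc_int : ‖∫ t in seg n, osc t‖ ≤ x ^ (1 + σ') * (2 + π) := by
    rw [hseg_eq, intervalIntegral.integral_congr (fun t _ ↦ hosc_eq t),
      intervalIntegral.integral_const_mul, norm_mul, norm_cpow_eq_rpow_re_of_pos hx0, ofReal_re]
    refine mul_le_mul_of_nonneg_left ?_ hxp
    have h := oscillatory_integral_le hlogx hα0 ρ.im (a := T - 1 / 20) (b := T + 1 / 20) (by linarith)
    refine h.trans ?_
    rw [div_le_iff₀ (mul_pos hα0 hlogx)]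
    nlinarith [Real.pi_pos]
  -- integrability of the two pieces on the segment
  have hI1 : IntegrableOn (fun t ↦ (1 / (ρ * (ρ + 1))) * osc t) (seg n) :=
    ((hosc_cont.const_mul _).integrableOn_Icc).mono_set Ico_subset_Icc_self
  have hI2 : IntegrableOn corr (seg n) := (hcorr_cont.integrableOn_Icc).mono_set Ico_subset_Icc_self
  -- assemble
  calc ‖∫ t in seg n, (x : ℂ) ^ (1 + ((σ' : ℂ) + t * I)) *
          (1 / (((σ' : ℂ) + t * I) * ((σ' : ℂ) + t * I + 1))) / ((σ' : ℂ) + t * I - ρ)‖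
      = ‖∫ t in seg n, ((1 / (ρ * (ρ + 1))) * osc t - corr t)‖ := by
        rw [setIntegral_congr_fun (measurableSet_seg n) fun t _ ↦ hP_eq t]
    _ = ‖(1 / (ρ * (ρ + 1))) * (∫ t in seg n, osc t) - ∫ t in seg n, corr t‖ := by
        rw [integral_sub hI1 hI2, MeasureTheory.integral_const_mul]
    _ ≤ ‖(1 / (ρ * (ρ + 1))) * ∫ t in seg n, osc t‖ + ‖∫ t in seg n, corr t‖ := norm_sub_le _ _
    _ ≤ (120 * (1 + T ^ 2)⁻¹) * (x ^ (1 + σ') * (2 + π)) +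
        x ^ (1 + σ') * (4000 * (1 + T ^ 2)⁻¹) * (1 / 10) := by
        rw [norm_mul]
        refine add_le_add (mul_le_mul (norm_kernel_zero_le hre him) hosc_int (norm_nonneg _)
          (by positivity)) hcorr_int
    _ = x ^ (1 + σ') * ((120 * (2 + π) + 400) * (1 + T ^ 2)⁻¹) := by ring

/-! ### The whole segment -/

/-- The absolute constant of the segment package (a choice of the constant of
`Literature.NumberTheory.LFunctions.DirichletSegments.exists_package`). [folklore] -/
def Cpkg : ℝ := Classical.choose DirichletSegments.exists_package

/-- `Cpkg > 0`. [folklore] -/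
theorem Cpkg_pos : 0 < Cpkg := (Classical.choose_spec DirichletSegments.exists_package).1

/-- The defining property of `Cpkg`. [folklore] -/
theorem Cpkg_spec : ∀ (q : ℕ) [NeZero q] (a : ZMod q) (t : ℝ),
    ∃ (Z : Finset ℂ) (w : ℂ → ℂ),
      (∀ ρ ∈ Z, (∃ χ : DirichletCharacter ℂ q, χ.LFunction ρ = 0) ∧
          3 / 20 ≤ ρ.re ∧ ρ.re < 1 ∧ |ρ.im - t| ≤ 2) ∧
      (∑ ρ ∈ Z, ‖w ρ‖ ≤ Cpkg * q.totient * (Real.log q + Real.log (|t| + 4))) ∧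
      (∀ s ∈ closedBall (2 + (t : ℂ) * I) (38 / 25), s ≠ 1 →
        (∀ χ : DirichletCharacter ℂ q, χ.LFunction s ≠ 0) →
        ‖(q.totient : ℂ) * LFunctionResidueClassAux a s - ∑ ρ ∈ Z, w ρ / (s - ρ)‖ ≤
          Cpkg * q.totient * (Real.log q + Real.log (|t| + 4))) ∧
      (∀ s ∈ closedBall (2 + (t : ℂ) * I) (38 / 25), s ≠ 1 →
        (∀ χ : DirichletCharacter ℂ q, χ.LFunction s ≠ 0) → ∀ d : ℝ, 0 < d →
        (∀ ρ ∈ Z, d ≤ ‖s - ρ‖) →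
        ‖(q.totient : ℂ) * LFunctionResidueClassAux a s‖ ≤
          Cpkg * q.totient * (1 + 1 / d) * (Real.log q + Real.log (|t| + 4))) :=
  (Classical.choose_spec DirichletSegments.exists_package).2

/-- The numerical constant `K₁ = 120(2+π) + 400 + 12/10` of the segment bound. [folklore] -/
def Kseg : ℝ := 120 * (2 + π) + 400 + 12 / 10

/-- `Kseg > 0`. [folklore] -/
theorem Kseg_pos : 0 < Kseg := by unfold Kseg; positivity

variable {q : ℕ} [NeZero q]

/-- **The bound on one segment.** Under the hypotheses of `abs_rieszMean_sub_le`, with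
`σ' = σ₁ + ε` and `Φ(t) = x^{1+s}F_{q,a}(s)/(s(s+1))`, `s = σ' + it`:
`‖∫_{S_n} Φ‖ ≤ 2 Cpkg Kseg φ(q) x^{1+σ'} (log q + 1) · log(|n/10| + 4)/(1 + (n/10)²)`.
[cite: MontgomeryVaughan2007, Lemma 12.6] -/
theorem norm_integral_seg_Phi_le {a : ZMod q} {σ₁ : ℝ} (hσ₁ : 1 / 2 ≤ σ₁)
    (hZ : ZerosRealPartLE q σ₁) {ε : ℝ} (hε : 0 < ε) (hσ'1 : σ₁ + ε < 1) {x : ℝ} (hx : 1 ≤ x)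
    (hεx : 1 ≤ ε * Real.log x) (n : ℤ) :
    ‖∫ t in seg n, ClassicalPsiData.Phi (Faux a) x ((σ₁ + ε : ℝ) + t * I)‖ ≤
      x ^ (1 + (σ₁ + ε)) * (2 * Cpkg * q.totient * Kseg) *
        (Real.log (|(n : ℝ) / 10| + 4) * (1 + ((n : ℝ) / 10) ^ 2)⁻¹) * (Real.log q + 1) := by
  have hx0 : 0 < x := by linarith
  set σ' : ℝ := σ₁ + ε with hσ'
  have hσ'σ₁ : σ₁ < σ' := by rw [hσ']; linarith
  have hσ'half : 1 / 2 ≤ σ' := by linarith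
  have hσ'2 : σ' ≤ 2 := by linarith
  have hlogx : 0 < Real.log x := by
    have : 0 < ε * Real.log x := by linarith
    exact pos_of_mul_pos_right this hε.le
  have hφ0 : (0 : ℝ) ≤ q.totient := Nat.cast_nonneg _
  have hlogq : 0 ≤ Real.log q := Real.log_natCast_nonneg q
  have hC₀0 := Cpkg_pos
  set T : ℝ := (n : ℝ) / 10 with hT
  set ℒ : ℝ := Real.log q + Real.log (|T| + 4) with hℒ
  have hℒ1 : 1 ≤ ℒ := DirichletZFR.one_le_ell q T
  have hℒ0 : 0 ≤ ℒ := by linarith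
  have hℒle : ℒ ≤ (Real.log q + 1) * Real.log (|T| + 4) := by
    have h3 : 1 ≤ Real.log (|T| + 4) := ClassicalZFRData.one_le_log_tau _
    rw [hℒ]; nlinarith
  obtain ⟨Z, w, hZprop, hw, hpf, -⟩ := Cpkg_spec q a T
  have hxpow : ∀ t : ℝ, ‖(x : ℂ) ^ (1 + ((σ' : ℂ) + t * I))‖ = x ^ (1 + σ') := by
    intro t
    rw [norm_cpow_eq_rpow_re_of_pos hx0]
    simp
  have hxp : 0 ≤ x ^ (1 + σ') := (Real.rpow_pos_of_pos hx0 _).le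
  -- facts valid at every point of the segment
  have hpt : ∀ t ∈ seg n,
      ((σ' : ℂ) + t * I) ∈ closedBall (2 + (T : ℂ) * I) (38 / 25) ∧ ((σ' : ℂ) + t * I) ≠ 1 ∧
      (∀ χ : DirichletCharacter ℂ q, χ.LFunction (σ' + t * I) ≠ 0) := by
    intro t ht
    have hmem := DirichletDisc.mem_closedBall_of_re_mem_Icc (σ := σ') (t := T) (t' := t)
      ⟨hσ'half, hσ'2⟩ (abs_sub_le_of_mem_seg ht)
    have hne1 : ((σ' : ℂ) + t * I) ≠ 1 := by
      intro h; have := congrArg Complex.re h; simp at this; linarith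
    exact ⟨hmem, hne1, LFunction_ne_zero_of_lt_re hσ₁ hZ (by simpa using hσ'σ₁) hne1⟩
  have hZfacts : ∀ ρ ∈ Z, ρ.re ≤ σ₁ ∧ 3 / 20 ≤ ρ.re ∧ ρ.re ≤ 2 ∧ |ρ.im - T| ≤ 2 := by
    intro ρ hρ
    obtain ⟨⟨χ, hχ⟩, hre0, hre1, him⟩ := hZprop ρ hρ
    exact ⟨hZ χ ρ hχ (by linarith) hre1, hre0, by linarith, him⟩
  -- the pieces of the integrand
  set Φ : ℝ → ℂ := fun t ↦ ClassicalPsiData.Phi (Faux a) x (σ' + t * I) with hΦdef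
  set kern : ℝ → ℂ := fun t ↦ 1 / (((σ' : ℂ) + t * I) * ((σ' : ℂ) + t * I + 1)) with hkern
  set D : ℝ → ℂ := fun t ↦ Faux a (σ' + t * I) - ∑ ρ ∈ Z, w ρ / ((σ' : ℂ) + t * I - ρ) with hD
  set P : ℂ → ℝ → ℂ := fun ρ t ↦ (x : ℂ) ^ (1 + ((σ' : ℂ) + t * I)) * kern t /
    ((σ' : ℂ) + t * I - ρ) with hP
  set Dp : ℝ → ℂ := fun t ↦ (x : ℂ) ^ (1 + ((σ' : ℂ) + t * I)) * D t * kern t with hDp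
  have hΦ_eq : ∀ t : ℝ, Φ t = Dp t + ∑ ρ ∈ Z, w ρ * P ρ t := by
    intro t
    simp only [hΦdef, ClassicalPsiData.Phi, ClassicalPsiData.kernel, hD, hP, hkern, hDp]
    have hS : ∑ ρ ∈ Z, w ρ * ((x : ℂ) ^ (1 + ((σ' : ℂ) + t * I)) *
        (1 / (((σ' : ℂ) + t * I) * ((σ' : ℂ) + t * I + 1))) / ((σ' : ℂ) + t * I - ρ)) =
        (x : ℂ) ^ (1 + ((σ' : ℂ) + t * I)) * (1 / (((σ' : ℂ) + t * I) * ((σ' : ℂ) + t * I + 1))) *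
          ∑ ρ ∈ Z, w ρ / ((σ' : ℂ) + t * I - ρ) := by
      rw [Finset.mul_sum]
      exact Finset.sum_congr rfl fun ρ _ ↦ by ring
    rw [hS]
    ring
  -- continuity (hence integrability on the segment) of the pieces
  have hx0' : (x : ℂ) ≠ 0 := ofReal_ne_zero.2 hx0.ne'
  have hcpow : Continuous fun t : ℝ ↦ (x : ℂ) ^ (1 + ((σ' : ℂ) + t * I)) := by
    refine continuous_iff_continuousAt.2 fun t ↦ ?_
    exact (continuousAt_const_cpow hx0').comp (f := fun t : ℝ ↦ 1 + ((σ' : ℂ) + t * I)) (by fun_prop)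
  have hs0 : ∀ t : ℝ, ((σ' : ℂ) + t * I) ≠ 0 := by
    intro t h; have := congrArg Complex.re h; simp at this; linarith
  have hs1 : ∀ t : ℝ, ((σ' : ℂ) + t * I) + 1 ≠ 0 := by
    intro t h; have := congrArg Complex.re h; simp at this; linarith
  have hkern_cont : Continuous kern := by
    rw [hkern]
    exact Continuous.div continuous_const (by fun_prop) fun t ↦ mul_ne_zero (hs0 t) (hs1 t)
  have hP_cont : ∀ ρ ∈ Z, Continuous (P ρ) := by
    intro ρ hρ
    have hρσ : ρ.re ≤ σ₁ := (hZfacts ρ hρ).1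
    simp only [hP]
    refine (hcpow.mul hkern_cont).div (by fun_prop) fun t h ↦ ?_
    have := congrArg Complex.re h; simp at this; linarith
  have hΦ_cont : Continuous Φ := by
    rw [hΦdef]; exact continuous_Phi_line hσ₁ hZ a hx0 (σ := σ') hσ'σ₁
  have hsumP_cont : Continuous fun t ↦ ∑ ρ ∈ Z, w ρ * P ρ t :=
    continuous_finsetSum Z fun ρ hρ ↦ continuous_const.mul (hP_cont ρ hρ)
  have hDp_eq : ∀ t : ℝ, Dp t = Φ t - ∑ ρ ∈ Z, w ρ * P ρ t := fun t ↦ by rw [hΦ_eq t]; ring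
  have hDp_cont : Continuous Dp := by
    have : Dp = fun t ↦ Φ t - ∑ ρ ∈ Z, w ρ * P ρ t := funext hDp_eq
    rw [this]; exact hΦ_cont.sub hsumP_cont
  have hvol : volume (seg n) < ⊤ := by rw [seg, Real.volume_Ico]; exact ENNReal.ofReal_lt_top
  -- (a) the `D`-piece
  have hDbound : ∀ t ∈ seg n, ‖Dp t‖ ≤ x ^ (1 + σ') * (Cpkg * q.totient * ℒ) * (12 * (1 + T ^ 2)⁻¹) := by
    intro t ht
    obtain ⟨hmem, hne1, hL⟩ := hpt t ht
    have hDt : ‖D t‖ ≤ Cpkg * q.totient * ℒ := by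
      have := hpf (σ' + t * I) hmem hne1 hL
      simpa only [hD, Faux] using this
    have hk : ‖kern t‖ ≤ 12 * (1 + T ^ 2)⁻¹ := by
      have h1 := ClassicalPsiData.norm_kernel_le_four_div hσ'half t
      simp only [ClassicalPsiData.kernel] at h1
      have h2 := inv_one_add_sq_le_of_mem_seg ht
      show ‖1 / (((σ' : ℂ) + t * I) * ((σ' : ℂ) + t * I + 1))‖ ≤ _
      calc ‖1 / (((σ' : ℂ) + t * I) * ((σ' : ℂ) + t * I + 1))‖ ≤ 4 * (1 + t ^ 2)⁻¹ := h1
        _ ≤ 4 * (3 * (1 + ((n : ℝ) / 10) ^ 2)⁻¹) := by gcongr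
        _ = 12 * (1 + T ^ 2)⁻¹ := by rw [hT]; ring
    show ‖(x : ℂ) ^ (1 + ((σ' : ℂ) + t * I)) * D t * kern t‖ ≤ _
    rw [norm_mul, norm_mul, hxpow t]
    gcongr
  have hDint : ‖∫ t in seg n, Dp t‖ ≤ x ^ (1 + σ') * (Cpkg * q.totient * ℒ) * (12 * (1 + T ^ 2)⁻¹) * (1 / 10) := by
    have := norm_setIntegral_le_of_norm_le_const hvol hDbound
    rwa [volume_real_seg] at this
  -- (b) the polar pieces
  have hPbound : ∀ ρ ∈ Z, ‖∫ t in seg n, P ρ t‖ ≤ x ^ (1 + σ') * ((120 * (2 + π) + 400) * (1 + T ^ 2)⁻¹) := by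
    intro ρ hρ
    obtain ⟨hρσ₁, hρre, hρre2, hρim⟩ := hZfacts ρ hρ
    have hlog : 1 ≤ (σ' - ρ.re) * Real.log x := by
      have h1 : ε ≤ σ' - ρ.re := by rw [hσ']; linarith
      exact le_trans hεx (mul_le_mul_of_nonneg_right h1 hlogx.le)
    have h := norm_integral_seg_polar_le hx0 hσ'half hσ'2 hρre hρre2 (by linarith) n hρim hlogx hlog
    simpa only [hP, hkern] using h
  -- (c) the whole segment
  have hIP : ∀ ρ ∈ Z, IntegrableOn (fun t ↦ w ρ * P ρ t) (seg n) := fun ρ hρ ↦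
    ((continuous_const.mul (hP_cont ρ hρ)).integrableOn_Icc).mono_set Ico_subset_Icc_self
  have hIsum : IntegrableOn (fun t ↦ ∑ ρ ∈ Z, w ρ * P ρ t) (seg n) :=
    integrable_finsetSum Z hIP
  have hID : IntegrableOn Dp (seg n) := (hDp_cont.integrableOn_Icc).mono_set Ico_subset_Icc_self
  have hw' : ∑ ρ ∈ Z, ‖w ρ‖ ≤ Cpkg * q.totient * ℒ := hw
  calc ‖∫ t in seg n, ClassicalPsiData.Phi (Faux a) x ((σ₁ + ε : ℝ) + t * I)‖
      = ‖∫ t in seg n, (Dp t + ∑ ρ ∈ Z, w ρ * P ρ t)‖ := by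
        rw [← setIntegral_congr_fun (measurableSet_seg n) fun t _ ↦ hΦ_eq t]
    _ = ‖(∫ t in seg n, Dp t) + ∑ ρ ∈ Z, w ρ * ∫ t in seg n, P ρ t‖ := by
        rw [integral_add hID hIsum, integral_finsetSum Z hIP]
        congr 2
        exact Finset.sum_congr rfl fun ρ _ ↦ MeasureTheory.integral_const_mul _ _
    _ ≤ ‖∫ t in seg n, Dp t‖ + ∑ ρ ∈ Z, ‖w ρ‖ * ‖∫ t in seg n, P ρ t‖ := by
        refine (norm_add_le _ _).trans (add_le_add le_rfl ((norm_sum_le _ _).trans ?_))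
        exact Finset.sum_le_sum fun ρ _ ↦ by rw [norm_mul]
    _ ≤ x ^ (1 + σ') * (Cpkg * q.totient * ℒ) * (12 * (1 + T ^ 2)⁻¹) * (1 / 10) +
        ∑ ρ ∈ Z, ‖w ρ‖ * (x ^ (1 + σ') * ((120 * (2 + π) + 400) * (1 + T ^ 2)⁻¹)) := by
        refine add_le_add hDint (Finset.sum_le_sum fun ρ hρ ↦ ?_)
        exact mul_le_mul_of_nonneg_left (hPbound ρ hρ) (norm_nonneg _)
    _ = x ^ (1 + σ') * (Cpkg * q.totient * ℒ) * (12 * (1 + T ^ 2)⁻¹) * (1 / 10) +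
        (∑ ρ ∈ Z, ‖w ρ‖) * (x ^ (1 + σ') * ((120 * (2 + π) + 400) * (1 + T ^ 2)⁻¹)) := by
        rw [Finset.sum_mul]
    _ ≤ x ^ (1 + σ') * (Cpkg * q.totient * ℒ) * (12 * (1 + T ^ 2)⁻¹) * (1 / 10) +
        (Cpkg * q.totient * ℒ) * (x ^ (1 + σ') * ((120 * (2 + π) + 400) * (1 + T ^ 2)⁻¹)) := by
        gcongr
    _ = x ^ (1 + σ') * (Cpkg * q.totient * Kseg) * (ℒ * (1 + T ^ 2)⁻¹) := by rw [Kseg]; ring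
    _ ≤ x ^ (1 + σ') * (Cpkg * q.totient * Kseg) *
          ((Real.log (|T| + 4) * (1 + T ^ 2)⁻¹) * (Real.log q + 1)) := by
        have hK := Kseg_pos
        have h1 : ℒ * (1 + T ^ 2)⁻¹ ≤ (Real.log (|T| + 4) * (1 + T ^ 2)⁻¹) * (Real.log q + 1) := by
          have := mul_le_mul_of_nonneg_right hℒle (inv_nonneg.2 (by positivity : (0:ℝ) ≤ 1 + T ^ 2))
          linarith [this]
        gcongr
    _ ≤ x ^ (1 + σ') * (2 * Cpkg * q.totient * Kseg) *
          ((Real.log (|T| + 4) * (1 + T ^ 2)⁻¹) * (Real.log q + 1)) := by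
        have hK := Kseg_pos
        have hw0 : 0 ≤ (Real.log (|T| + 4) * (1 + T ^ 2)⁻¹) * (Real.log q + 1) :=
          mul_nonneg (mul_nonneg (Real.log_nonneg (by linarith [abs_nonneg T])) (by positivity))
            (by linarith)
        gcongr
        nlinarith [mul_nonneg hC₀0.le hφ0]
    _ = _ := by ring

/-! ### The main estimate -/

/-- **`ψ₁(x; Λ_{q,a}) − x²/2 ≪ φ(q)(log q + 1) x^{1+σ₁+ε}` without logarithms.** There is an
absolute constant `C` such that for all `q ≥ 1`, `(a, q) = 1`, `1/2 ≤ σ₁`, under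
`ZerosRealPartLE q σ₁` (all zeros of all `L(s, χ)` mod `q` in the critical strip have `Re ≤ σ₁`),
for `0 < ε`, `σ₁ + ε < 1`, and all `x ≥ 1` with `ε log x ≥ 1`:
`|ψ₁(x; Λ_{q,a}) − (x − 1)²/2| ≤ C φ(q) (log q + 1) x^{1+σ₁+ε}`, where
`ψ₁(x; Λ_{q,a}) = ∑_{n ≤ x} Λ_{q,a}(n)(x − n) = φ(q) ∑_{n ≤ x, n ≡ a (q)} Λ(n)(x − n)`.
[cite: MontgomeryVaughan2007, Theorem 12.5 with §13.1 (conditional form)] -/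
theorem abs_rieszMean_sub_le :
    ∃ C : ℝ, 0 < C ∧ ∀ (q : ℕ) [NeZero q] (a : ZMod q), IsUnit a → ∀ σ₁ : ℝ, 1 / 2 ≤ σ₁ →
      ZerosRealPartLE q σ₁ → ∀ ε : ℝ, 0 < ε → σ₁ + ε < 1 → ∀ x : ℝ, 1 ≤ x → 1 ≤ ε * Real.log x →
        |ClassicalPsiData.rieszMean (Lam a) x - (x - 1) ^ 2 / 2| ≤
          C * q.totient * (Real.log q + 1) * x ^ (1 + σ₁ + ε) := by
  -- the absolute constant
  set S₀ : ℝ := ∑' n : ℤ, Real.log (|(n : ℝ) / 10| + 4) * (1 + ((n : ℝ) / 10) ^ 2)⁻¹ with hS₀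
  have hS₀0 : 0 ≤ S₀ := tsum_nonneg fun n ↦
    mul_nonneg (Real.log_nonneg (by linarith [abs_nonneg ((n : ℝ) / 10)])) (by positivity)
  have hC₀0 := Cpkg_pos
  have hK := Kseg_pos
  refine ⟨(1 / (2 * π)) * (2 * Cpkg * Kseg) * S₀ + 1, by positivity,
    fun q _ a ha σ₁ hσ₁ hZ ε hε hσ'1 x hx hεx ↦ ?_⟩
  have hx0 : 0 < x := by linarith
  have hσ'σ₁ : σ₁ < σ₁ + ε := by linarith
  have hσ'2 : σ₁ + ε ≤ 2 := by linarith
  have hφ0 : (0 : ℝ) ≤ q.totient := Nat.cast_nonneg _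
  have hlogq : 0 ≤ Real.log q := Real.log_natCast_nonneg q
  set Φ : ℝ → ℂ := fun t ↦ ClassicalPsiData.Phi (Faux a) x ((σ₁ + ε : ℝ) + t * I) with hΦdef
  -- the line-integral representation and its segment decomposition
  have hrep := rieszMean_sub_eq_integral ha hσ₁ hZ hσ'σ₁ hσ'2 hx
  have hint : Integrable Φ :=
    integrable_Phi hσ₁ hZ a hx0 hε (σ := σ₁ + ε) le_rfl hσ'2
  have hsum : HasSum (fun n : ℤ ↦ ∫ t in seg n, Φ t) (∫ t, Φ t) := by
    have h := hasSum_integral_iUnion (f := Φ) (μ := volume) measurableSet_seg pairwise_disjoint_seg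
      (by rw [iUnion_seg]; exact hint.integrableOn)
    rwa [iUnion_seg, Measure.restrict_univ] at h
  -- the bound on each segment, summed
  set b : ℤ → ℝ := fun n ↦ x ^ (1 + (σ₁ + ε)) * (2 * Cpkg * q.totient * Kseg) *
    (Real.log (|(n : ℝ) / 10| + 4) * (1 + ((n : ℝ) / 10) ^ 2)⁻¹) * (Real.log q + 1) with hb
  have hseg : ∀ n : ℤ, ‖∫ t in seg n, Φ t‖ ≤ b n := fun n ↦
    norm_integral_seg_Phi_le hσ₁ hZ hε hσ'1 hx hεx n
  have hb_summable : Summable b :=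
    (summable_seg_weight.mul_left (x ^ (1 + (σ₁ + ε)) * (2 * Cpkg * q.totient * Kseg))).mul_right
      (Real.log q + 1)
  have hnorm_summable : Summable fun n : ℤ ↦ ‖∫ t in seg n, Φ t‖ :=
    Summable.of_nonneg_of_le (fun n ↦ norm_nonneg _) hseg hb_summable
  have htotal : ‖∫ t, Φ t‖ ≤ ∑' n : ℤ, b n := by
    rw [← hsum.tsum_eq]
    exact (norm_tsum_le_tsum_norm hnorm_summable).trans (hnorm_summable.tsum_le_tsum hseg hb_summable)
  have htsum_b : ∑' n : ℤ, b n =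
      x ^ (1 + (σ₁ + ε)) * (2 * Cpkg * q.totient * Kseg) * S₀ * (Real.log q + 1) := by
    rw [hb, hS₀, tsum_mul_right, tsum_mul_left]
  -- conclude
  have hfinal : |ClassicalPsiData.rieszMean (Lam a) x - (x - 1) ^ 2 / 2| =
      ‖(1 / (2 * π) : ℂ)‖ * ‖∫ t, Φ t‖ := by
    rw [← norm_mul, ← hrep, Complex.norm_real, Real.norm_eq_abs]
  rw [hfinal]
  have hn2π : ‖(1 / (2 * π) : ℂ)‖ = 1 / (2 * π) := by
    rw [show (1 / (2 * π) : ℂ) = ((1 / (2 * π) : ℝ) : ℂ) by push_cast; rfl, Complex.norm_real,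
      Real.norm_of_nonneg (by positivity)]
  rw [hn2π]
  have hxσ : x ^ (1 + (σ₁ + ε)) = x ^ (1 + σ₁ + ε) := by ring_nf
  calc 1 / (2 * π) * ‖∫ t, Φ t‖
      ≤ 1 / (2 * π) * (x ^ (1 + (σ₁ + ε)) * (2 * Cpkg * q.totient * Kseg) * S₀ * (Real.log q + 1)) := by
        rw [← htsum_b]; gcongr
    _ = ((1 / (2 * π)) * (2 * Cpkg * Kseg) * S₀) * q.totient * (Real.log q + 1) * x ^ (1 + σ₁ + ε) := by
        rw [hxσ]; ring
    _ ≤ ((1 / (2 * π)) * (2 * Cpkg * Kseg) * S₀ + 1) * q.totient * (Real.log q + 1) * x ^ (1 + σ₁ + ε) := by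
        have : 0 ≤ (q.totient : ℝ) * (Real.log q + 1) * x ^ (1 + σ₁ + ε) := by positivity
        nlinarith

end Literature.NumberTheory.LFunctions.ResidueRiesz

end
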